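import Mathlib
import HarnessLib

/-!
# Fold optics of the Weil minimiser: equal wall rays `g/√(g² − 1)` and the geometric invariant `∫₁^∞ dg/(g√(g² − 1)) = π/2`

Helper file (`--supports stmt-RiemannHypothesis-0098`), pure elementary real analysis, no definitions.  Seat rh-explicit-weil-5
gen13 (file of record `HOME/rh-explicit-weil-5/WEIL5-XFOLD.md`; sealed blind ledger PREREG-XFOLD-weil5-g13, 09a8d4e4…).

Context (documentation only; nothing below depends on it).  The even-sector minimiser of the compressed Weil form on the
window `[-a, a]` (`c = 2πe^{2a}`) radiates to the zeros through its two wall cusps; at height `γ` the two wall rays are the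
`k = 1` branch of the transport chirp `ω(τ) = cτ²/√(τ² − 1)` (the `χ = 0` case of `Theorems/WeilTransportFoldCaustic.lean`),
which folds at `γ* = 2c`.  Writing `g = γ/(2c) > 1` and `w = τ²`, the two rays solve `c²w² − γ²w + γ² = 0`, i.e.
`w± = 2g(g ± √(g² − 1))`, and stationary phase gives each ray the intensity `w/|w − 2|` in far-wall units.  This file proves:

* `foldRoots_sum`, `foldRoots_prod`         : `w₊ + w₋ = 4g²`, `w₊·w₋ = 4g²` (Vieta for the two wall rays);
* `innerRay_intensity`, `outerRay_intensity` : `w₋/(2 − w₋) = g/√(g² − 1) = w₊/(w₊ − 2)` — THE TWO WALL RAYS ARE EQUALLY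
  BRIGHT AT EVERY HEIGHT, with geometric shape factor `S_geom(γ) = g/√(g² − 1) = 1/√(1 − (2c/γ)²)`;
* `hasDerivAt_arccos_inv`                    : `d/dg arccos(1/g) = 1/(g·√(g² − 1))` for `g > 1` (i.e. `S_geom(g)/g²` is an exact
  derivative);
* `integral_foldGeometric`                   : `∫_{(1,∞)} dg/(g√(g² − 1)) = π/2` — the geometric-optics value of the cell's
  energy–wall invariant `X = 2c∫_{2c}^∞ S_geom dγ/γ²` (the flat cusp law gives `1`; measured `1.64–1.78`).

Standard axioms only; no `sorry`.
-/

set_option linter.dupNamespace false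
set_option autoImplicit false

noncomputable section

open Real MeasureTheory Set Filter Topology

namespace Summit.RiemannHypothesis.RiemannHypothesis.Theorems.WeilFoldOptics

/-- Vieta, sum: the two wall rays `w± = 2g(g ± √(g² − 1))` satisfy `w₊ + w₋ = 4g²` (`= γ²/c²`). -/
theorem foldRoots_sum (g : ℝ) :
    2 * g * (g + Real.sqrt (g ^ 2 - 1)) + 2 * g * (g - Real.sqrt (g ^ 2 - 1)) = 4 * g ^ 2 := by
  ring

/-- Vieta, product: for `g ≥ 1`, `w₊ · w₋ = 4g²` (`= γ²/c²`): the roots of `c²w² − γ²w + γ² = 0` in units `γ = 2cg`. -/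
theorem foldRoots_prod (g : ℝ) (hg : 1 ≤ g) :
    (2 * g * (g + Real.sqrt (g ^ 2 - 1))) * (2 * g * (g - Real.sqrt (g ^ 2 - 1))) = 4 * g ^ 2 := by
  have hs : Real.sqrt (g ^ 2 - 1) ^ 2 = g ^ 2 - 1 := Real.sq_sqrt (by nlinarith)
  linear_combination (-(4 * g ^ 2)) * hs

/-- Both rays solve the ray equation `w² − 4g²w + 4g² = 0` (i.e. `c²w² − γ²w + γ² = 0` with `γ = 2cg`), `g ≥ 1`. -/
theorem foldRoot_eq (g : ℝ) (hg : 1 ≤ g) (ε : ℝ) (hε : ε = 1 ∨ ε = -1) :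
    (2 * g * (g + ε * Real.sqrt (g ^ 2 - 1))) ^ 2 - 4 * g ^ 2 * (2 * g * (g + ε * Real.sqrt (g ^ 2 - 1))) + 4 * g ^ 2
      = 0 := by
  have hs : Real.sqrt (g ^ 2 - 1) ^ 2 = g ^ 2 - 1 := Real.sq_sqrt (by nlinarith)
  have he : ε ^ 2 = 1 := by rcases hε with h | h <;> simp [h]
  linear_combination (4 * g ^ 2 * ε ^ 2) * hs + (4 * g ^ 2 * (g ^ 2 - 1)) * he

/-- THE INNER (near-wall) RAY: for `g > 1`, with `w₋ = 2g(g − √(g² − 1))`, its intensity `w₋/(2 − w₋)` equals `g/√(g² − 1)`. -/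
theorem innerRay_intensity (g : ℝ) (hg : 1 < g) :
    2 * g * (g - Real.sqrt (g ^ 2 - 1)) / (2 - 2 * g * (g - Real.sqrt (g ^ 2 - 1))) = g / Real.sqrt (g ^ 2 - 1) := by
  have hr0 : 0 < Real.sqrt (g ^ 2 - 1) := Real.sqrt_pos.mpr (by nlinarith)
  have hs : Real.sqrt (g ^ 2 - 1) ^ 2 = g ^ 2 - 1 := Real.sq_sqrt (by nlinarith)
  have hlt : Real.sqrt (g ^ 2 - 1) < g := by nlinarith [hs, hr0]
  -- 2 − w₋ = 2√(g²−1)·(g − √(g²−1)) > 0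
  have hden : 2 - 2 * g * (g - Real.sqrt (g ^ 2 - 1)) = 2 * Real.sqrt (g ^ 2 - 1) * (g - Real.sqrt (g ^ 2 - 1)) := by
    linear_combination 2 * hs
  have hden_ne : 2 - 2 * g * (g - Real.sqrt (g ^ 2 - 1)) ≠ 0 := by
    rw [hden]; exact (mul_pos (by positivity) (by linarith)).ne'
  rw [div_eq_div_iff hden_ne hr0.ne']
  linear_combination (-(2 * g)) * hs

/-- THE OUTER (far-wall) RAY: for `g > 1`, with `w₊ = 2g(g + √(g² − 1))`, its intensity `w₊/(w₊ − 2)` equals `g/√(g² − 1)` —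
the same as the inner ray's: the two wall rays are equally bright at every height above the fold. -/
theorem outerRay_intensity (g : ℝ) (hg : 1 < g) :
    2 * g * (g + Real.sqrt (g ^ 2 - 1)) / (2 * g * (g + Real.sqrt (g ^ 2 - 1)) - 2) = g / Real.sqrt (g ^ 2 - 1) := by
  have hr0 : 0 < Real.sqrt (g ^ 2 - 1) := Real.sqrt_pos.mpr (by nlinarith)
  have hs : Real.sqrt (g ^ 2 - 1) ^ 2 = g ^ 2 - 1 := Real.sq_sqrt (by nlinarith)
  -- w₊ − 2 = 2√(g²−1)·(g + √(g²−1)) > 0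
  have hden : 2 * g * (g + Real.sqrt (g ^ 2 - 1)) - 2 = 2 * Real.sqrt (g ^ 2 - 1) * (g + Real.sqrt (g ^ 2 - 1)) := by
    linear_combination (-2) * hs
  have hden_ne : 2 * g * (g + Real.sqrt (g ^ 2 - 1)) - 2 ≠ 0 := by
    rw [hden]; exact (mul_pos (by positivity) (by linarith)).ne'
  rw [div_eq_div_iff hden_ne hr0.ne']
  linear_combination (2 * g) * hs

/-- Hence the geometric (incoherent two-ray) shape factor `S_geom = (i₁ + i₂)/2 = g/√(g² − 1)`. -/
theorem geomShape_eq (g : ℝ) (hg : 1 < g) :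
    (2 * g * (g - Real.sqrt (g ^ 2 - 1)) / (2 - 2 * g * (g - Real.sqrt (g ^ 2 - 1)))
      + 2 * g * (g + Real.sqrt (g ^ 2 - 1)) / (2 * g * (g + Real.sqrt (g ^ 2 - 1)) - 2)) / 2
      = g / Real.sqrt (g ^ 2 - 1) := by
  rw [innerRay_intensity g hg, outerRay_intensity g hg]; ring

/-- `S_geom` in the height variable: for `γ > 2c > 0`, `g/√(g² − 1) = 1/√(1 − (2c/γ)²)` with `g = γ/(2c)`. -/
theorem geomShape_height (c γ : ℝ) (hc : 0 < c) (hγ : 2 * c < γ) :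
    (γ / (2 * c)) / Real.sqrt ((γ / (2 * c)) ^ 2 - 1) = 1 / Real.sqrt (1 - (2 * c / γ) ^ 2) := by
  have hγ0 : 0 < γ := by linarith
  have h2c : 0 < 2 * c := by linarith
  have hg : 0 < γ / (2 * c) := div_pos hγ0 h2c
  have key : (γ / (2 * c)) ^ 2 - 1 = (γ / (2 * c)) ^ 2 * (1 - (2 * c / γ) ^ 2) := by
    field_simp
  rw [key, Real.sqrt_mul (sq_nonneg _), Real.sqrt_sq hg.le]
  have hpos : 0 < 1 - (2 * c / γ) ^ 2 := by
    have : 2 * c / γ < 1 := (div_lt_one hγ0).mpr hγ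
    have h0 : 0 < 2 * c / γ := div_pos h2c hγ0
    nlinarith
  have hs : 0 < Real.sqrt (1 - (2 * c / γ) ^ 2) := Real.sqrt_pos.mpr hpos
  field_simp

/-- The derivative behind `X_geom`: for `g > 1`, `d/dg arccos(g⁻¹) = 1/(g·√(g² − 1))`. -/
theorem hasDerivAt_arccos_inv (g : ℝ) (hg : 1 < g) :
    HasDerivAt (fun x : ℝ => Real.arccos x⁻¹) (1 / (g * Real.sqrt (g ^ 2 - 1))) g := by
  have hg0 : 0 < g := by linarith
  have hgi : 0 < g⁻¹ := inv_pos.mpr hg0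
  have hgi1 : g⁻¹ < 1 := inv_lt_one_of_one_lt₀ hg
  have h1 : HasDerivAt (fun x : ℝ => x⁻¹) (-(g ^ 2)⁻¹) g := hasDerivAt_inv hg0.ne'
  have h2 : HasDerivAt Real.arccos (-(1 / Real.sqrt (1 - (g⁻¹) ^ 2))) g⁻¹ :=
    Real.hasDerivAt_arccos (by linarith) hgi1.ne
  have h : HasDerivAt (fun x : ℝ => Real.arccos x⁻¹) (-(1 / Real.sqrt (1 - (g⁻¹) ^ 2)) * (-(g ^ 2)⁻¹)) g :=
    h2.comp g h1
  have hsq : Real.sqrt (1 - (g⁻¹) ^ 2) = Real.sqrt (g ^ 2 - 1) / g := by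
    have : 1 - (g⁻¹) ^ 2 = (g ^ 2 - 1) / g ^ 2 := by field_simp
    rw [this, Real.sqrt_div' _ (sq_nonneg g), Real.sqrt_sq hg0.le]
  have hr0 : 0 < Real.sqrt (g ^ 2 - 1) := Real.sqrt_pos.mpr (by nlinarith)
  refine h.congr_deriv ?_
  rw [hsq]
  field_simp

/-- **X_geom = π/2.**  `∫_{(1,∞)} dg/(g√(g² − 1)) = π/2`: the geometric-optics value of the energy–wall invariant
`X = 2c ∫_{2c}^∞ S_geom(γ) dγ/γ²` of the fold (`S_geom = 1/√(1 − (2c/γ)²)`; substitute `γ = 2cg`), against `1` for the flat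
cusp law and the measured `1.64–1.78`. -/
theorem integral_foldGeometric :
    ∫ g in Ioi (1 : ℝ), 1 / (g * Real.sqrt (g ^ 2 - 1)) = π / 2 := by
  have hcont : ContinuousWithinAt (fun x : ℝ => Real.arccos x⁻¹) (Ici 1) 1 :=
    (Real.continuous_arccos.continuousAt.comp_continuousWithinAt
      ((continuousAt_inv₀ one_ne_zero).continuousWithinAt))
  have hderiv : ∀ x ∈ Ioi (1 : ℝ), HasDerivAt (fun x : ℝ => Real.arccos x⁻¹) (1 / (x * Real.sqrt (x ^ 2 - 1))) x :=
    fun x hx => hasDerivAt_arccos_inv x hx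
  have hpos : ∀ x ∈ Ioi (1 : ℝ), 0 ≤ 1 / (x * Real.sqrt (x ^ 2 - 1)) := by
    intro x hx
    have hx1 : 1 < x := hx
    have : 0 < Real.sqrt (x ^ 2 - 1) := Real.sqrt_pos.mpr (by nlinarith)
    positivity
  have hlim : Tendsto (fun x : ℝ => Real.arccos x⁻¹) atTop (𝓝 (π / 2)) := by
    rw [← Real.arccos_zero]
    exact (Real.continuous_arccos.tendsto 0).comp tendsto_inv_atTop_zero
  have h := integral_Ioi_of_hasDerivAt_of_nonneg hcont hderiv hpos hlim
  simpa [inv_one, Real.arccos_one] using h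

/-- The same invariant on any window: for `c > 0`, `2c · ∫_{(2c,∞)} dγ/(γ²√(1 − (2c/γ)²))`-type scaling reduces to
`integral_foldGeometric` via `γ = 2cg`; recorded here in the scale-free form actually used by the tables:
`∫_{(1,∞)} (g/√(g²−1))/g² dg = π/2`. -/
theorem integral_geomShape_div_sq :
    ∫ g in Ioi (1 : ℝ), (g / Real.sqrt (g ^ 2 - 1)) / g ^ 2 = π / 2 := by
  rw [← integral_foldGeometric]
  refine setIntegral_congr_fun measurableSet_Ioi (fun g hg => ?_)
  have hg1 : (1 : ℝ) < g := hg
  have hg0 : (0 : ℝ) < g := by linarith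
  have hr0 : 0 < Real.sqrt (g ^ 2 - 1) := Real.sqrt_pos.mpr (by nlinarith)
  field_simp

end Summit.RiemannHypothesis.RiemannHypothesis.Theorems.WeilFoldOptics

end
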